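import Summits.NavierStokesRegularity.FluidComputer.PalasekTowerRegisterGlobalCeiling
import Literature.Analysis.FluidPDE.TaoQuantitativeKNSSBridge
import Literature.Analysis.FluidPDE.KNSSGradientBoundWindowEnd
import Literature.Analysis.FluidPDE.TaoQuantitativeClass
import Literature.Analysis.FluidPDE.NSEnstrophyPersistenceForced
import Literature.Analysis.FluidPDE.NSCriticalClosureTao2021
import Literature.Analysis.FluidPDE.SpaceTimeCalculusC1

/-!
# REGISTER v2.3′: the STRAIN CEILING of every silent window — `‖∇u‖ ≤ C·M²` for every
# finite-energy classical continuation bounded by `M`, with UNIVERSAL `C` (KNSS 2009, Prop. 4.1 / (4.6))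

Cell `ns-blowup`, seat `ns-blowup-ecbridge-5` (g5; D-0074 GROUP C «BRIDGE SUPPORT»; bears_on LADDER-NS
N1, route `PalasekTowerBreakdown`, child crux `HeredityFromTwo` = item stmt-NavierStokesRegularity-19250,
registered halves `AprioriCeiling` (p425507) / `ReadoutFloors` (p415576) — supports only, nothing
claimed; holder of record of the item: seat `ns-palasek-19250-p1`). Companion of
`PalasekTowerRegisterGlobalKatoWindow.lean` (p429305, the SPEED side of the short-time theory) and of
`PalasekTowerStageSmoothness.lean` (p437029: every stage has bounded derivatives, with a bound THAT
DEPENDS ON THE STAGE). LABEL: E–C typing + kernel analysis (every statement PROVED; no `Prop`, no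
named fact — the deep input, Koch–Nadirashvili–Seregin–Šverák 2009 Prop. 4.1 with (4.6), is
DISCHARGED in the tree: `KNSS2009_prop41_mild_holds`, `exists_norm_fderiv_le_sq_of_isKNSSDriftMild`).
WHAT THIS IS NOT: not Navier–Stokes evidence — no stage, flow or tower is constructed or claimed; the
theorems say what EVERY finite-energy classical continuation of a registered stage satisfies on the
silent part of its window; they decide neither half.

* §1 `exists_strainCeiling_silent` — UNIVERSAL `ε > 0`, `C ≥ 0`: a classical solution of the forced
  system (`ν = 1`) on `[0, T'] × ℝ³` with a Clay-class force silent from `t₁`, Schwartz datum, finite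
  energy, and `‖u‖ ≤ M` on `[a, T']` (`t₁ ≤ a`) has `‖∇u(t, x)‖ ≤ C·M²` for all `t ∈ [a, T']` with
  `M²(t − a) ≥ ε`, ENDPOINT INCLUDED. Chain of tree theorems: Tao's class on the slab
  (`hasBoundedSobolevNormsOn_of_clayForce`) → the translate by `a` is an UNFORCED
  `IsHkClassicalSolutionOn` (`isClassicalNSSolutionOn_translate_of_silent`) → Tao-class for some
  pressure (`IsHkClassicalSolutionOn.exists_isTaoSolutionOn`) → a restarted bounded mild field with
  bound `M` (`IsTaoSolutionOn.isKNSSDriftMild_clamp`) → (4.6) at the window end on the OPEN window →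
  the endpoint by continuity of `s ↦ ∇u(s, x)` (`continuousOn_fderiv_slice_of_contDiffOn`).
* §2 register reading (ANY rates, ANY margins, `ν = 1`, QUIET schedule, `k ≥ 1`):
  `Stage.exists_strainCeiling_continuation` (the continuations of `AprioriCeiling` / `ReadoutFloors`),
  `Stage.exists_strainCeiling_readout` (at `τ_{k+1}` with `M = c₂ Y_{k+1}`, under
  `(c₂Y_{k+1})²(τ_{k+1} − τ_k) ≥ ε`), `Stage.exists_strainCeiling_top` (a registered stage at level
  `k+1 ≥ 2` on its own silent stretch `[τ_1, τ_{k+1}]`).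
* §3 under RIGIDITY `(c₂Y_{k+1})²(τ_{k+1} − τ_k) = c₂² c₅ log N_{k+1}·Y_{k+1}²/A_k ≥
  c₂² c₅ log N₀·N_{k+1}^{β−2} → ∞` (`Schedule.Rigid.nextCeiling_sq_mul_window[_ge]`, `tendsto_…`,
  `exists_level_…` — the threshold level `k₀(R, ε)` is UNIFORM IN THE SCHEDULE), hence with no window
  hypothesis: `exists_level_strainCeiling_readout`, `Stage.exists_level_strainCeiling_top`,
  `Stage.exists_level_strain_floor_le_ceiling` (a late strained stage, IF ONE EXISTS, certifies
  `c₁ A_{k+1} ≤ C (c₂ Y_{k+1})²`).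

Reading on `TowerRates.wide` (rigid `c₁ = 1`, `c₂ = 5/3`): the registered strain floor
`c₁ A_{k+1} = N_{k+1}^{23/10}` of `ReadoutFloors` and this DESIGN-UNIFORM ceiling `C(25/9)N_{k+1}^{13/5}`
differ by `C(25/9)N_{k+1}^{3/10}` — the same level-Reynolds factor `N^{3/10}` as the circulation band
of `PalasekTowerRegisterGlobalCoreFloors` (p430943). No BY-VALUE claim about `k₀` is made (KNSS's
`ε` is not explicit). By-name corollaries for the halves: Theorems-side companion
`PalasekTowerBreakdownHeredityFromTwoStrainCeiling.lean`.

References: G. Koch, N. Nadirashvili, G. Seregin, V. Šverák, Acta Math. 203 (2009), §4 Prop. 4.1,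
(4.6) [cite: KochNadirashviliSereginSverak2009, Prop. 4.1 (4.6)]; T. Tao, Anal. PDE 6 (2013), Cor. 11.1
[cite: Tao2011, Cor. 11.1]; S. Palasek, arXiv:2605.13827 §4 [cite: Palasek2026ElementaryModel, §4].
-/

noncomputable section

namespace Summit.NavierStokesRegularity.FluidComputer.PalasekTowerClayBridge

open Set MeasureTheory Filter Topology Function Real
open scoped ENNReal ContDiff NNReal
open Literature.Analysis.FluidPDE

/-! ## §1 The strain ceiling of a silent window (any Clay flow at unit viscosity) -/

/-- **The strain ceiling of a silent window.** UNIVERSAL `ε > 0`, `C ≥ 0` (those of KNSS (4.6) at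
the end of the smoothing window, `exists_norm_fderiv_le_sq_of_isKNSSDriftMild`) such that every
classical solution `(u, p)` of the forced system at unit viscosity on `[0, T'] × ℝ³` with a Clay-class
force SILENT from `t₁`, a Schwartz datum `u(0)` and finite energy, bounded by `M` on a sub-window
`[a, T']` (`t₁ ≤ a`, `0 ≤ a < T'`), satisfies `‖∇u(t, x)‖ ≤ C · M²` for every `t ∈ [a, T']` with
`M²(t - a) ≥ ε` — endpoint included — and every `x` (chain: see the module docstring).
[cite: KochNadirashviliSereginSverak2009, Prop. 4.1 with (4.6), k = 1 (arXiv:0709.3599v1 p. 8)] -/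
theorem exists_strainCeiling_silent :
    ∃ ε : ℝ, 0 < ε ∧ ∃ C : ℝ, 0 ≤ C ∧
      ∀ {f u : ℝ → EuclideanSpace ℝ (Fin 3) → EuclideanSpace ℝ (Fin 3)}
        {p : ℝ → EuclideanSpace ℝ (Fin 3) → ℝ} {T' t₁ a M : ℝ},
        IsClassicalNSSolutionOn (Icc 0 T') 1 f u p →
        IsSmoothOnHalfSpace f → HasRapidSpaceTimeDecay f → HasRapidSpatialDecay (u 0) →
        (∃ E : ℝ≥0∞, E < ⊤ ∧ ∀ t ∈ Icc 0 T', ∫⁻ x, ‖u t x‖ₑ ^ 2 ≤ E) →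
        (∀ t, t₁ ≤ t → f t = 0) → t₁ ≤ a → 0 ≤ a → a < T' →
        (∀ t ∈ Icc a T', ∀ x, ‖u t x‖ ≤ M) →
        ∀ t ∈ Icc a T', ε ≤ M ^ 2 * (t - a) → ∀ x, ‖fderiv ℝ (u t) x‖ ≤ C * M ^ 2 := by
  obtain ⟨ε, hε, C, hC, H⟩ := exists_norm_fderiv_le_sq_of_isKNSSDriftMild
  refine ⟨2 * ε, by positivity, C, hC, ?_⟩
  intro f u p T' t₁ a M hcl hfs hfd h0 hE hsil ht₁a ha haT hM t ht hεt x
  have hT'0 : 0 < T' := lt_of_le_of_lt ha haT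
  have hTa : 0 < T' - a := sub_pos.2 haT
  have hM2 : 0 < M ^ 2 := by
    by_contra hle
    have : M ^ 2 * (t - a) = 0 := by rw [le_antisymm (not_lt.1 hle) (sq_nonneg M), zero_mul]
    linarith
  obtain ⟨E, hEtop, hEle⟩ := hE
  have hE' : ∃ C : ℝ≥0, ∀ t ∈ Icc 0 T', ∫⁻ x, ‖u t x‖ₑ ^ 2 ≤ C :=
    ⟨E.toNNReal, fun s hs => (hEle s hs).trans (ENNReal.coe_toNNReal hEtop.ne).ge⟩
  have hHk : HasBoundedSobolevNormsOn (Icc 0 T') u :=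
    hcl.hasBoundedSobolevNormsOn_of_clayForce one_pos hT'0 hE' h0 hfs hfd
  have hw : IsClassicalNSSolutionOn (Icc 0 (T' - a)) 1 0 (fun r => u (r + a))
      (fun r => p (r + a)) :=
    isClassicalNSSolutionOn_translate_of_silent hcl ha haT fun s hs => hsil s (ht₁a.trans hs)
  have hHkw : IsHkClassicalSolutionOn (Icc 0 (T' - a)) (fun r => u (r + a))
      (fun r => p (r + a)) := by
    refine ⟨hw, fun n => ?_⟩
    obtain ⟨Cn, hCn⟩ := hHk n
    refine ⟨max 1 Cn, fun r hr => ?_⟩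
    rw [ENNReal.coe_max, ENNReal.coe_one]
    exact eLpNorm_two_le_max_of_lintegral_sq_le
      (hCn (r + a) ⟨by linarith [hr.1], by linarith [hr.2]⟩)
  obtain ⟨q, hq⟩ := hHkw.exists_isTaoSolutionOn hTa
  have hN : ∀ r ∈ Icc 0 (T' - a), ∀ y, ‖u (r + a) y‖ ≤ M := fun r hr y =>
    hM (r + a) ⟨by linarith [hr.1], by linarith [hr.2]⟩ y
  have hK := hq.isKNSSDriftMild_clamp hTa hN
  have hopen : ∀ s ∈ Ico (a + ε / M ^ 2) T', ‖fderiv ℝ (u s) x‖ ≤ C * M ^ 2 := by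
    intro s hs
    have hεM : 0 < ε / M ^ 2 := div_pos hε hM2
    have hr0 : 0 < s - a := by linarith [hs.1]
    have hrT : s - a < T' - a := by linarith [hs.2]
    have hεr : ε ≤ M ^ 2 * (s - a) := by
      have h1 : ε / M ^ 2 ≤ s - a := by linarith [hs.1]
      rw [div_le_iff₀ hM2] at h1
      linarith
    have h := H hK (s - a) ⟨hr0, hrT⟩ hεr x
    have hclamp : max 0 (min (s - a) (T' - a)) = s - a := by
      rw [min_eq_left hrT.le, max_eq_right hr0.le]
    simp only [hclamp, sub_add_cancel] at h
    exact h
  have hu1 : ContDiffOn ℝ 1 (uncurry u) (Icc 0 T' ×ˢ univ) :=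
    (show ContDiffOn ℝ ∞ (uncurry u) (Icc 0 T' ×ˢ univ) from hcl.smooth_velocity).of_le
      (by exact_mod_cast le_top)
  have hcF : ContinuousOn (fun z : ℝ × EuclideanSpace ℝ (Fin 3) => fderiv ℝ (u z.1) z.2)
      (Icc 0 T' ×ˢ univ) :=
    continuousOn_fderiv_slice_of_contDiffOn hu1 (uniqueDiffOn_Icc hT'0)
  have hcg : ContinuousOn (fun s : ℝ => ‖fderiv ℝ (u s) x‖) (Icc 0 T') :=
    (hcF.comp (continuous_id.prodMk continuous_const).continuousOn
      fun s hs => ⟨hs, mem_univ _⟩).norm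
  have htI : t ∈ Icc 0 T' := ⟨ha.trans ht.1, ht.2⟩
  have hlt : a + ε / M ^ 2 < t := by
    have h1 : 2 * ε / M ^ 2 ≤ t - a := by rw [div_le_iff₀ hM2]; linarith
    have h2 : ε / M ^ 2 < 2 * ε / M ^ 2 := div_lt_div_of_pos_right (by linarith) hM2
    linarith
  have hclos : t ∈ closure (Ico (a + ε / M ^ 2) T') := by
    rw [closure_Ico (by linarith [ht.2] : a + ε / M ^ 2 ≠ T')]
    exact ⟨hlt.le, ht.2⟩
  have hcw : ContinuousWithinAt (fun s : ℝ => ‖fderiv ℝ (u s) x‖) (Ico (a + ε / M ^ 2) T') t :=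
    (hcg.continuousWithinAt htI).mono fun s hs =>
      ⟨by linarith [hs.1, (div_pos hε hM2).le], hs.2.le⟩
  exact hcw.closure_le hclos continuousWithinAt_const hopen


/-! ## §2 Register reading: every finite-energy continuation of a registered stage is strain-capped -/

namespace Stage

/-- **The strain ceiling of a registered stage's continuation** (any rates, ANY margins, `ν = 1`,
QUIET schedule, `k ≥ 1`): a classical solution `(u, p)` on `[0, T']`, `T' > τ_k`, with the schedule's
force, agreeing in velocity with a registered stage `s` at level `k` on `[0, τ_k]`, of finite energy
and with `‖u‖ ≤ M` on `[τ_k, T'] × ℝ³`, has `‖∇u(t, x)‖ ≤ C·M²` for every `t ∈ [τ_k, T']` with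
`M²(t - τ_k) ≥ ε` (the force is silent from `τ_1 ≤ τ_k`; `u(0) = s.u(0) = S.u₀` is Schwartz). These
are the continuations quantified in `AprioriCeiling` / `ReadoutFloors` (`M = c₂ Y_{k+1}`).
[cite: KochNadirashviliSereginSverak2009, Prop. 4.1 with (4.6), k = 1 (arXiv:0709.3599v1 p. 8)] -/
theorem exists_strainCeiling_continuation :
    ∃ ε : ℝ, 0 < ε ∧ ∃ C : ℝ, 0 ≤ C ∧
      ∀ {R : TowerRates} {S : Schedule R} {m : Margins R} {k : ℕ}, S.Quiet → 1 ≤ k →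
        ∀ (s : Stage 1 R S m k) {T' M : ℝ}, S.τ k < T' →
        ∀ {u : ℝ → EuclideanSpace ℝ (Fin 3) → EuclideanSpace ℝ (Fin 3)}
          {p : ℝ → EuclideanSpace ℝ (Fin 3) → ℝ},
          IsClassicalNSSolutionOn (Icc 0 T') 1 S.f u p →
          (∀ t ∈ Icc 0 (S.τ k), u t = s.u t) →
          (∃ E : ℝ≥0∞, E < ⊤ ∧ ∀ t ∈ Icc 0 T', ∫⁻ x, ‖u t x‖ₑ ^ 2 ≤ E) →
          (∀ t ∈ Icc (S.τ k) T', ∀ x, ‖u t x‖ ≤ M) →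
          ∀ t ∈ Icc (S.τ k) T', ε ≤ M ^ 2 * (t - S.τ k) →
            ∀ x, ‖fderiv ℝ (u t) x‖ ≤ C * M ^ 2 := by
  obtain ⟨ε, hε, C, hC, H⟩ := exists_strainCeiling_silent
  refine ⟨ε, hε, C, hC, ?_⟩
  intro R S m k hQ hk s T' M hT' u p hcl hagree hE hM t ht hεt x
  have h0 : HasRapidSpatialDecay (u 0) := by
    rw [hagree 0 ⟨le_rfl, (S.τ_pos k).le⟩, s.initial]
    exact S.datum_decay
  exact H hcl S.force_smooth S.force_decay h0 hE (fun t' ht' => hQ t' ht') (S.τ_mono hk)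
    (S.τ_pos k).le hT' hM t ht hεt x

/-- **The strain ceiling AT THE NEXT READOUT** (any rates, any margins, `ν = 1`, quiet, `k ≥ 1`):
whenever `(c₂ Y_{k+1})² (τ_{k+1} - τ_k) ≥ ε`, EVERY finite-energy classical continuation of a
registered stage to `[0, τ_{k+1}]` inside the next ceiling `c₂ Y_{k+1}` (the hypotheses of
`ReadoutFloors`) has `‖∇u(τ_{k+1}, x)‖ ≤ C (c₂ Y_{k+1})²` for all `x`: the registered strain floor
`c₁ A_{k+1}` sits under a DESIGN-UNIFORM parabolic-smoothing ceiling of the same readout.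
[cite: KochNadirashviliSereginSverak2009, Prop. 4.1 with (4.6), k = 1 (arXiv:0709.3599v1 p. 8)] -/
theorem exists_strainCeiling_readout :
    ∃ ε : ℝ, 0 < ε ∧ ∃ C : ℝ, 0 ≤ C ∧
      ∀ {R : TowerRates} {S : Schedule R} {m : Margins R} {k : ℕ}, S.Quiet → 1 ≤ k →
        ε ≤ (S.c₂ * R.Y (k + 1)) ^ 2 * (S.τ (k + 1) - S.τ k) →
        ∀ (s : Stage 1 R S m k)
          {u : ℝ → EuclideanSpace ℝ (Fin 3) → EuclideanSpace ℝ (Fin 3)}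
          {p : ℝ → EuclideanSpace ℝ (Fin 3) → ℝ},
          IsClassicalNSSolutionOn (Icc 0 (S.τ (k + 1))) 1 S.f u p →
          (∀ t ∈ Icc 0 (S.τ k), u t = s.u t) →
          (∃ E : ℝ≥0∞, E < ⊤ ∧ ∀ t ∈ Icc 0 (S.τ (k + 1)), ∫⁻ x, ‖u t x‖ₑ ^ 2 ≤ E) →
          (∀ t ∈ Icc 0 (S.τ (k + 1)), ∀ x, ‖u t x‖ ≤ S.c₂ * R.Y (k + 1)) →
          ∀ x, ‖fderiv ℝ (u (S.τ (k + 1))) x‖ ≤ C * (S.c₂ * R.Y (k + 1)) ^ 2 := by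
  obtain ⟨ε, hε, C, hC, H⟩ := exists_strainCeiling_continuation
  refine ⟨ε, hε, C, hC, ?_⟩
  intro R S m k hQ hk hwin s u p hcl hagree hE hceil x
  have hτ : S.τ k < S.τ (k + 1) := S.τ_lt_succ k
  exact H hQ hk s hτ hcl hagree hE (fun t ht y => hceil t ⟨(S.τ_pos k).le.trans ht.1, ht.2⟩ y)
    (S.τ (k + 1)) ⟨hτ.le, le_rfl⟩ hwin x

/-- **The strain ceiling of a registered stage on its own silent stretch** (any rates, any
margins, `ν = 1`, QUIET schedule, level `k + 1 ≥ 2`): a registered stage at level `k + 1` (force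
silent on `[τ_1, τ_{k+1}]`, speed `≤ c₂ Y_{k+1}` on `[0, τ_{k+1}]`) has `‖∇u(t, x)‖ ≤ C (c₂ Y_{k+1})²`
at every `t ∈ [τ_1, τ_{k+1}]` with `(c₂ Y_{k+1})² (t - τ_1) ≥ ε` — the scale-explicit, design-uniform
form of `Stage.exists_norm_fderiv_le` (`PalasekTowerStageSmoothness`).
[cite: KochNadirashviliSereginSverak2009, Prop. 4.1 with (4.6), k = 1 (arXiv:0709.3599v1 p. 8)] -/
theorem exists_strainCeiling_top :
    ∃ ε : ℝ, 0 < ε ∧ ∃ C : ℝ, 0 ≤ C ∧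
      ∀ {R : TowerRates} {S : Schedule R} {m : Margins R} {k : ℕ}, S.Quiet → 1 ≤ k →
        ∀ (s : Stage 1 R S m (k + 1)),
        ∀ t ∈ Icc (S.τ 1) (S.τ (k + 1)), ε ≤ (S.c₂ * R.Y (k + 1)) ^ 2 * (t - S.τ 1) →
          ∀ x, ‖fderiv ℝ (s.u t) x‖ ≤ C * (S.c₂ * R.Y (k + 1)) ^ 2 := by
  obtain ⟨ε, hε, C, hC, H⟩ := exists_strainCeiling_silent
  refine ⟨ε, hε, C, hC, ?_⟩
  intro R S m k hQ hk s t ht hεt x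
  have h0 : HasRapidSpatialDecay (s.u 0) := by
    rw [s.initial]; exact S.datum_decay
  have hlt : S.τ 1 < S.τ (k + 1) := S.τ_strictMono (by omega)
  exact H s.classical S.force_smooth S.force_decay h0 s.energy (fun t' ht' => hQ t' ht') le_rfl
    (S.τ_pos 1).le hlt
    (fun t' ht' y => s.ceiling (k + 1) le_rfl t' ⟨(S.τ_pos 1).le.trans ht'.1, ht'.2⟩ y) t ht hεt x

end Stage

/-! ## §3 Under rigidity the window is long in the next ceiling's units: the reading holds at
every level beyond some `k₀(R)` -/

namespace TowerRates

variable (R : TowerRates)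

/-- `Y_j² / A_j = N_j^{β-2}` (rate algebra). [folklore] -/
theorem Y_sq_div_A (j : ℕ) : R.Y j ^ 2 / R.A j = R.N j ^ (R.β - 2) := by
  have hN := R.N_pos j
  simp only [TowerRates.Y, TowerRates.A]
  rw [← Real.rpow_natCast, ← Real.rpow_mul hN.le, ← Real.rpow_sub hN]
  congr 1
  push_cast
  ring

/-- The amplitudes are monotone: `A_k ≤ A_{k+1}` (as `N_k ≤ N_{k+1}`, cf. `TowerRates.N_le_N_succ` of
`PalasekTowerRegisterGlobalLetterWitness`). [folklore] -/
theorem A_le_A_succ (k : ℕ) : R.A k ≤ R.A (k + 1) := by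
  have hN : R.N k ≤ R.N (k + 1) := by
    simp only [TowerRates.N]
    refine Real.rpow_le_rpow_of_exponent_le R.one_lt_N₀.le ?_
    rw [pow_succ]
    exact le_mul_of_one_le_right (pow_nonneg (zero_le_one.trans R.one_lt_b.le) k) R.one_lt_b.le
  exact Real.rpow_le_rpow (R.N_pos k).le hN (by linarith [R.two_lt_β])

/-- `N_{k+1}^{β-2} → ∞`. [folklore] -/
theorem tendsto_N_succ_rpow_atTop :
    Tendsto (fun k : ℕ => R.N (k + 1) ^ (R.β - 2)) atTop atTop :=
  (tendsto_rpow_atTop (by linarith [R.two_lt_β])).comp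
    (R.tendsto_N_atTop.comp (tendsto_add_atTop_nat 1))

end TowerRates

namespace Schedule.Rigid

variable {R : TowerRates} {S : Schedule R}

/-- Under rigidity the window in the NEXT ceiling's units is
`(c₂ Y_{k+1})² (τ_{k+1} - τ_k) = c₂² · c₅ log N_{k+1} · Y_{k+1}² / A_k`. [folklore] -/
theorem nextCeiling_sq_mul_window (h : S.Rigid) (k : ℕ) :
    (S.c₂ * R.Y (k + 1)) ^ 2 * (S.τ (k + 1) - S.τ k) =
      S.c₂ ^ 2 * (S.c₅ * Real.log (R.N (k + 1))) * (R.Y (k + 1) ^ 2 / R.A k) := by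
  rw [h.window_eq k]
  have hA := (R.A_pos k).ne'
  field_simp
  ring

/-- … and it dominates `c₂² · c₅ log N₀ · N_{k+1}^{β-2}` (`log N_{k+1} ≥ log N₀`, `A_k ≤ A_{k+1}`,
`Y²/A = N^{β-2}`). [folklore] -/
theorem nextCeiling_sq_mul_window_ge (h : S.Rigid) (k : ℕ) :
    S.c₂ ^ 2 * (S.c₅ * Real.log R.N₀) * R.N (k + 1) ^ (R.β - 2) ≤
      (S.c₂ * R.Y (k + 1)) ^ 2 * (S.τ (k + 1) - S.τ k) := by
  rw [h.nextCeiling_sq_mul_window k, ← R.Y_sq_div_A (k + 1)]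
  have hc₅ : 0 < S.c₅ := by rw [h.c₅_eq]; have := R.one_lt_b; have := R.two_lt_β; positivity
  have hlog₀ : 0 < Real.log R.N₀ := Real.log_pos R.one_lt_N₀
  have hlog : Real.log R.N₀ ≤ Real.log (R.N (k + 1)) :=
    Real.log_le_log (by linarith [R.one_lt_N₀]) (R.N₀_le_N (k + 1))
  have hY2 : 0 ≤ R.Y (k + 1) ^ 2 := sq_nonneg _
  have hfrac : R.Y (k + 1) ^ 2 / R.A (k + 1) ≤ R.Y (k + 1) ^ 2 / R.A k :=
    div_le_div_of_nonneg_left hY2 (R.A_pos k) (R.A_le_A_succ k)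
  have hc2 : 0 ≤ S.c₂ ^ 2 := sq_nonneg _
  calc S.c₂ ^ 2 * (S.c₅ * Real.log R.N₀) * (R.Y (k + 1) ^ 2 / R.A (k + 1))
      ≤ S.c₂ ^ 2 * (S.c₅ * Real.log (R.N (k + 1))) * (R.Y (k + 1) ^ 2 / R.A (k + 1)) := by
        gcongr; exact div_nonneg hY2 (R.A_pos (k + 1)).le
    _ ≤ S.c₂ ^ 2 * (S.c₅ * Real.log (R.N (k + 1))) * (R.Y (k + 1) ^ 2 / R.A k) := by
        have : 0 ≤ S.c₂ ^ 2 * (S.c₅ * Real.log (R.N (k + 1))) :=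
          mul_nonneg hc2 (mul_nonneg hc₅.le (hlog₀.le.trans hlog))
        exact mul_le_mul_of_nonneg_left hfrac this

/-- **Under rigidity the growth window is eventually long in the next ceiling's units**:
`(c₂ Y_{k+1})² (τ_{k+1} - τ_k) → ∞` (rigid constants `c₂ = 5/3`, `c₅ = 4bβ`; any rates).
[folklore] -/
theorem tendsto_nextCeiling_sq_mul_window (h : S.Rigid) :
    Tendsto (fun k : ℕ => (S.c₂ * R.Y (k + 1)) ^ 2 * (S.τ (k + 1) - S.τ k)) atTop atTop := by
  have hc₅ : 0 < S.c₅ := by rw [h.c₅_eq]; have := R.one_lt_b; have := R.two_lt_β; positivity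
  have hc₂ : 0 < S.c₂ ^ 2 := by rw [h.c₂_eq]; norm_num
  exact tendsto_atTop_mono (fun k => h.nextCeiling_sq_mul_window_ge k)
    ((R.tendsto_N_succ_rpow_atTop).const_mul_atTop
      (mul_pos hc₂ (mul_pos hc₅ (Real.log_pos R.one_lt_N₀))))

/-- Hence for every threshold `ε` there is a level `k₀` (depending on the rates only) beyond which
`ε ≤ (c₂ Y_{k+1})² (τ_{k+1} - τ_k)` on EVERY rigid schedule. [folklore] -/
theorem exists_level_nextCeiling_sq_mul_window_ge (R : TowerRates) (ε : ℝ) :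
    ∃ k₀ : ℕ, ∀ (S : Schedule R), S.Rigid → ∀ k, k₀ ≤ k →
      ε ≤ (S.c₂ * R.Y (k + 1)) ^ 2 * (S.τ (k + 1) - S.τ k) := by
  have hb := R.one_lt_b
  have hβ := R.two_lt_β
  have hconst : 0 < (5 / 3 : ℝ) ^ 2 * (4 * R.b * R.β * Real.log R.N₀) :=
    mul_pos (by norm_num) (mul_pos (by positivity) (Real.log_pos R.one_lt_N₀))
  have hT : Tendsto (fun k : ℕ => (5 / 3 : ℝ) ^ 2 * (4 * R.b * R.β * Real.log R.N₀) *
      R.N (k + 1) ^ (R.β - 2)) atTop atTop :=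
    (R.tendsto_N_succ_rpow_atTop).const_mul_atTop hconst
  obtain ⟨k₀, hk₀⟩ := eventually_atTop.1 (tendsto_atTop.1 hT ε)
  refine ⟨k₀, fun S hS k hk => ?_⟩
  have := hS.nextCeiling_sq_mul_window_ge k
  rw [hS.c₅_eq, hS.c₂_eq] at this
  rw [hS.c₂_eq]
  exact (hk₀ k hk).trans this

end Schedule.Rigid

/-- **THE STRAIN CEILING OF EVERY LATE READOUT, UNCONDITIONALLY** (any rates `R`, any margins,
`ν = 1`): a level `k₀` (depending on `R` only) and a universal `C ≥ 0` such that on every RIGID QUIET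
schedule, at every level `k ≥ max 1 k₀`, every finite-energy classical continuation of a registered
level-`k` stage to `[0, τ_{k+1}]` inside the next ceiling has `‖∇u(τ_{k+1}, x)‖ ≤ C (c₂ Y_{k+1})²`.
(Rigid `c₂ = 5/3`, `A = N^β`, `Y = N^{β-1}`: floor `c₁ A_{k+1}` and ceiling differ by
`C (25/9) N_{k+1}^{β-2}`, on `TowerRates.wide` the level-Reynolds factor `N^{3/10}` of the circulation
band of `PalasekTowerRegisterGlobalCoreFloors`.) Nothing here says a stage exists.
[cite: KochNadirashviliSereginSverak2009, Prop. 4.1 with (4.6), k = 1 (arXiv:0709.3599v1 p. 8)] -/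
theorem exists_level_strainCeiling_readout (R : TowerRates) :
    ∃ k₀ : ℕ, ∃ C : ℝ, 0 ≤ C ∧
      ∀ {S : Schedule R} {m : Margins R} {k : ℕ}, S.Rigid → S.Quiet → 1 ≤ k → k₀ ≤ k →
        ∀ (s : Stage 1 R S m k)
          {u : ℝ → EuclideanSpace ℝ (Fin 3) → EuclideanSpace ℝ (Fin 3)}
          {p : ℝ → EuclideanSpace ℝ (Fin 3) → ℝ},
          IsClassicalNSSolutionOn (Icc 0 (S.τ (k + 1))) 1 S.f u p →
          (∀ t ∈ Icc 0 (S.τ k), u t = s.u t) →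
          (∃ E : ℝ≥0∞, E < ⊤ ∧ ∀ t ∈ Icc 0 (S.τ (k + 1)), ∫⁻ x, ‖u t x‖ₑ ^ 2 ≤ E) →
          (∀ t ∈ Icc 0 (S.τ (k + 1)), ∀ x, ‖u t x‖ ≤ S.c₂ * R.Y (k + 1)) →
          ∀ x, ‖fderiv ℝ (u (S.τ (k + 1))) x‖ ≤ C * (S.c₂ * R.Y (k + 1)) ^ 2 := by
  obtain ⟨ε, -, C, hC, H⟩ := Stage.exists_strainCeiling_readout
  obtain ⟨k₀, hk₀⟩ := Schedule.Rigid.exists_level_nextCeiling_sq_mul_window_ge R ε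
  exact ⟨k₀, C, hC, fun hRig hQ hk hk' s _ _ hcl hagree hE hceil x =>
    H hQ hk (hk₀ _ hRig _ hk') s hcl hagree hE hceil x⟩

/-- **Every registered stage at a late level is strain-capped at its top readout, unconditionally**
(any rates `R`, any margins, `ν = 1`): a level `k₀(R)` and a universal `C ≥ 0` such that on every
RIGID QUIET schedule every registered stage at level `k + 1`, `k ≥ max 1 k₀`, has
`‖∇u(τ_{k+1}, x)‖ ≤ C (c₂ Y_{k+1})²` for all `x`. Nothing here says a stage exists.
[cite: KochNadirashviliSereginSverak2009, Prop. 4.1 with (4.6), k = 1 (arXiv:0709.3599v1 p. 8)] -/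
theorem Stage.exists_level_strainCeiling_top (R : TowerRates) :
    ∃ k₀ : ℕ, ∃ C : ℝ, 0 ≤ C ∧
      ∀ {S : Schedule R} {m : Margins R} {k : ℕ}, S.Rigid → S.Quiet → 1 ≤ k → k₀ ≤ k →
        ∀ (s : Stage 1 R S m (k + 1)) (x : EuclideanSpace ℝ (Fin 3)),
          ‖fderiv ℝ (s.u (S.τ (k + 1))) x‖ ≤ C * (S.c₂ * R.Y (k + 1)) ^ 2 := by
  obtain ⟨ε, -, C, hC, H⟩ := Stage.exists_strainCeiling_top
  obtain ⟨k₀, hk₀⟩ := Schedule.Rigid.exists_level_nextCeiling_sq_mul_window_ge R ε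
  refine ⟨k₀, C, hC, fun {S m k} hRig hQ hk hk' s x => ?_⟩
  have hlt : S.τ 1 ≤ S.τ k := S.τ_mono hk
  have hwin := hk₀ S hRig k hk'
  refine H hQ hk s (S.τ (k + 1)) ⟨(S.τ_mono (by omega : 1 ≤ k + 1)), le_rfl⟩ ?_ x
  have hsq : 0 ≤ (S.c₂ * R.Y (k + 1)) ^ 2 := sq_nonneg _
  calc ε ≤ (S.c₂ * R.Y (k + 1)) ^ 2 * (S.τ (k + 1) - S.τ k) := hwin
    _ ≤ (S.c₂ * R.Y (k + 1)) ^ 2 * (S.τ (k + 1) - S.τ 1) :=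
        mul_le_mul_of_nonneg_left (by linarith) hsq

/-- **Floor under ceiling**: whenever a registered (strained: `Margins.withStrain m`) stage at a late
level `k + 1`, `k ≥ max 1 k₀(R)`, of a rigid quiet schedule EXISTS, its registered strain floor and
the universal strain ceiling at the same readout give `c₁ A_{k+1} ≤ C (c₂ Y_{k+1})²` — with the
rigid constants, `N_{k+1}^β ≤ C (25/9) N_{k+1}^{2β-2}`. A necessary condition every late rung
certifies; vacuous while no stage is exhibited. [folklore] -/
theorem Stage.exists_level_strain_floor_le_ceiling (R : TowerRates) :
    ∃ k₀ : ℕ, ∃ C : ℝ, 0 ≤ C ∧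
      ∀ {S : Schedule R} {m : Margins R} {k : ℕ}, S.Rigid → S.Quiet → 1 ≤ k → k₀ ≤ k →
        ∀ (_s : Stage 1 R S (Margins.withStrain m) (k + 1)),
          S.c₁ * R.A (k + 1) ≤ C * (S.c₂ * R.Y (k + 1)) ^ 2 := by
  obtain ⟨k₀, C, hC, H⟩ := Stage.exists_level_strainCeiling_top R
  refine ⟨k₀, C, hC, fun {S m k} hRig hQ hk hk' s => ?_⟩
  obtain ⟨x, -, hx⟩ := s.strain (k + 1) le_rfl
  exact hx.trans (H hRig hQ hk hk' s x)

end Summit.NavierStokesRegularity.FluidComputer.PalasekTowerClayBridge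

end
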